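import Literature.Analysis.FluidPDE.FractionalNSPrescribedEnergyIteration
import Literature.Analysis.FluidPDE.FractionalNSPrescribedEnergyIterationLimit
import Literature.Analysis.FluidPDE.FractionalNSPrescribedEnergyFamiliesParameters
import Literature.Analysis.FluidPDE.OnsagerFlexibilityProofs
import Literature.Analysis.FunctionSpaces.HolderInterpolation
import HarnessLib

/-!
# Colombo–De Lellis–De Rosa 2018, Prop. 2.2 from the iteration Prop. 3.2 (proof of §8.3)

Analysis/FluidPDE proofs-only file. We PROVE the reduction
`ColomboDeLellisDeRosa2018_prop22_of_prop32 : ColomboDeLellisDeRosa2018_prop32 →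
ColomboDeLellisDeRosa2018_prop22`, i.e. the source's proof of Prop. 2.2 (§8.3, pp. 18–19, with
the proof of Thm. 2.1, §3.2 p. 8) GIVEN the output of the convex-integration iteration
(Prop. 3.2 with Lemma 3.1 run universally, the named fact of
`FractionalNSPrescribedEnergyIteration.lean`):

1. parameters: for `α < α + ε < 1/5` choose `c > 5/2` with `(α+ε)c < 1/2`, then `b` below the
   `b₁(α,c)` of the iteration with `(α+ε)cb < 1/2`, `b(α+ε)/(1-2α) ≤ 2α+3ε`,
   `(b+1)(α+ε) ≤ 2α+3ε` (`exists_cdldr_c`, `exists_cdldr_b`), then `a₀(α,b,c)`; the constant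
   `C(α,ε)` is assembled from `M, C₀, a₀, b, c` BEFORE the family is given;
2. for a family with bounds `E₁ ≤ E₂` run the iteration with the universal
   `a = max{a₀, C₀E₁, C₀E₂^{1/((2c-1)b-1)}}` ((81) of the source);
3. pass to the limit `v_e = lim_q v_{e,q}` (pointwise `limUnder`; uniform convergence from (27),
   `FractionalNSPrescribedEnergyIterationLimit`): (a) weak solution since `‖R̊_q‖₀ ≤ ηδ_{q+1} → 0`
   (`isWeakFracNSSolutionOn_lim`), continuity on the slab; (b) the energy identity from
   (35) (`integral_norm_sq_lim`); (d) the common datum from the common initial slices;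
4. (c): sup bound `M + M∑δ_{q+1}^{1/2}`, Hölder seminorm by interpolation between (27) and the
   Lipschitz form of (28) (`norm_le_mul_rpow_of_le_of_le_mul`), summed geometrically and
   uniformly in `a ≥ a₀` (`cdldr_increment_le_geom`, `cdldr_holderIncrement_le_geom`), plus the
   starting slice `[v_{e,0}]_ϑ ≤ 2M(C₀ max{a^{b/(1-2α)}, a^bE₁, E₂^r})^ϑ`, and finally the exponent
   bookkeeping `cdldr_amax_rpow_le` giving `C(α,ε) max{E₁^{2α+3ε}, E₂^{(2α+4ε)/3}}`.

`ColomboDeLellisDeRosa2018_prop22_holds` itself is NOT here: it needs the iteration fact to be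
discharged (the convex-integration construction of §§4–8 of the source).

## References

* M. Colombo, C. De Lellis, L. De Rosa, Comm. Math. Phys. 362 (2018) (held: arXiv:1708.05666),
  §2 Prop. 2.2; §3.2 proof of Thm. 2.1 (p. 8); §8.3 (pp. 18–19); §10 (101).
  [`ColomboDelellisDerosa2018`]
-/

noncomputable section

open MeasureTheory Set Filter Function Topology
open scoped ENNReal NNReal

namespace Literature.Analysis.FluidPDE

/-! ## Hölder constants from real increment bounds -/

section Holder

/-- A real increment bound `‖f x - f y‖ ≤ K d(x,y)^ϑ` (`K, ϑ ≥ 0`) is a Hölder bound with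
constant `K` and exponent `ϑ` in Mathlib's `ℝ≥0∞`-valued sense. [folklore] -/
theorem holderWith_of_norm_sub_le_mul_rpow {X G : Type*} [PseudoMetricSpace X]
    [SeminormedAddCommGroup G] {f : X → G} {K ϑ : ℝ} (hK : 0 ≤ K) (hϑ : 0 ≤ ϑ)
    (h : ∀ x y, ‖f x - f y‖ ≤ K * dist x y ^ ϑ) :
    HolderWith (Real.toNNReal K) (Real.toNNReal ϑ) f := by
  intro x y
  calc edist (f x) (f y) = ENNReal.ofReal ‖f x - f y‖ := by rw [edist_dist, dist_eq_norm]
    _ ≤ ENNReal.ofReal (K * dist x y ^ ϑ) := ENNReal.ofReal_le_ofReal (h x y)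
    _ = ENNReal.ofReal K * ENNReal.ofReal (dist x y ^ ϑ) := ENNReal.ofReal_mul hK
    _ = (Real.toNNReal K : ℝ≥0∞) * edist x y ^ (Real.toNNReal ϑ : ℝ) := by
        rw [Real.coe_toNNReal ϑ hϑ, edist_dist, ENNReal.ofReal_rpow_of_nonneg dist_nonneg hϑ]
        rfl

/-- The inhomogeneous Hölder norm `‖f‖_∞ + [f]_ϑ` from a pointwise bound `B` and a real increment
bound `K d^ϑ`: `eBoundedHolderNorm ϑ f ≤ B + K`. [folklore] -/
theorem eBoundedHolderNorm_le_ofReal_add {X G : Type*} [PseudoMetricSpace X]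
    [NormedAddCommGroup G] {f : X → G} {B K ϑ : ℝ} (hB : 0 ≤ B) (hK : 0 ≤ K) (hϑ : 0 ≤ ϑ)
    (hb : ∀ x, ‖f x‖ ≤ B) (h : ∀ x y, ‖f x - f y‖ ≤ K * dist x y ^ ϑ) :
    FunctionSpaces.eBoundedHolderNorm (Real.toNNReal ϑ) f ≤ ENNReal.ofReal (B + K) := by
  rw [FunctionSpaces.eBoundedHolderNorm_def, ENNReal.ofReal_add hB hK]
  exact add_le_add (FunctionSpaces.eSupNorm_le_ofReal hb)
    (holderWith_of_norm_sub_le_mul_rpow hK hϑ h).eHolderNorm_le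

end Holder

/-! ## The reduction -/

section NS

/-- The amplitudes `δ_{q+1} = a^{-b^{q+1}}` tend to `0` for `a > 1`, `b > 1`. [folklore] -/
theorem CDLDR.tendsto_amp_succ {a b : ℝ} (ha : 1 < a) (hb : 1 < b) :
    Tendsto (fun q => CDLDR.amp a b (q + 1)) atTop (𝓝 0) := by
  obtain ⟨hρ0, hρ1⟩ := cdldr_ratio_mem ha hb one_pos
  refine tendsto_zero_of_abs_le_geom hρ0.le hρ1 fun q => ?_
  rw [abs_of_pos (CDLDR.amp_pos (by linarith) b (q + 1)), CDLDR.amp_def]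
  have h := rpow_neg_mul_pow_le_geom ha le_rfl hb one_pos q
  simpa only [one_mul] using h

/-- **Colombo–De Lellis–De Rosa 2018, Prop. 2.2 follows from their iteration Prop. 3.2** (run
universally over the family, §8.3) by passing to the limit `q → ∞` — the proof of Prop. 2.2
printed in §8.3 of the source together with the proof of Thm. 2.1 (§3.2): see the file header
for the four steps. [cite: ColomboDelellisDerosa2018, §8.3 (proof of Prop. 2.2) and §3.2 (proof of Thm. 2.1)] -/
theorem ColomboDeLellisDeRosa2018_prop22_of_prop32 (H : ColomboDeLellisDeRosa2018_prop32) :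
    ColomboDeLellisDeRosa2018_prop22 := by
  intro α hα hα5
  obtain ⟨c₀, T₀, M, η, C₀, hc₀, hT₀, hM, hη, hC₀, Hc⟩ := H α hα hα5
  refine ⟨1, one_pos, fun ε hε _ hαε => ?_⟩
  -- Step 1: the parameters `c`, `b`, `a₀`
  have hϑ : 0 < α + ε := by linarith
  have hϑ1 : α + ε ≤ 1 := by linarith
  have h2α : 0 < 1 - 2 * α := by linarith
  obtain ⟨c, hc, hϑc⟩ := exists_cdldr_c hϑ hαε
  have hc0 : 0 < c := by linarith
  obtain ⟨b₁, hb₁, Hb⟩ := Hc c hc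
  obtain ⟨b, hb, hbb₁, hκ, e1, e3⟩ := exists_cdldr_b hα hα5 hε hαε hc0 hϑc hb₁
  obtain ⟨a₀, ha₀, Ha⟩ := Hb b hb hbb₁
  have hM0 : 0 ≤ M := zero_le_one.trans hM
  have hC₀0 : 0 ≤ C₀ := zero_le_one.trans hC₀
  have ha₀0 : 0 ≤ a₀ := by linarith
  have hκ' : 0 < 1 / 2 - (α + ε) * c * b := by linarith
  -- Step 2: the constants (independent of the family)
  obtain ⟨hρA0, hρA1⟩ := cdldr_ratio_mem ha₀ hb (one_half_pos (α := ℝ))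
  obtain ⟨hρK0, hρK1⟩ := cdldr_ratio_mem ha₀ hb hκ'
  set ρA : ℝ := a₀ ^ (-(1 / 2 * (b - 1))) with hρA_def
  set ρK : ℝ := a₀ ^ (-((1 / 2 - (α + ε) * c * b) * (b - 1))) with hρK_def
  set SA : ℝ := M * (1 - ρA)⁻¹ with hSA_def
  set SK : ℝ := 12 * M * (1 - ρK)⁻¹ with hSK_def
  set Q : ℝ := a₀ ^ (b / (1 - 2 * α) * (α + ε)) + 2 * C₀ ^ (b / (1 - 2 * α) * (α + ε)) +
    a₀ ^ (b * (α + ε)) + 2 * C₀ ^ (b * (α + ε)) + 1 with hQ_def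
  have hSA0 : 0 ≤ SA := mul_nonneg hM0 (inv_nonneg.2 (by linarith))
  have hSK0 : 0 ≤ SK := mul_nonneg (by linarith) (inv_nonneg.2 (by linarith))
  have hQ1 : 1 ≤ Q := by
    have h1 : 0 ≤ a₀ ^ (b / (1 - 2 * α) * (α + ε)) := Real.rpow_nonneg ha₀0 _
    have h2 : 0 ≤ C₀ ^ (b / (1 - 2 * α) * (α + ε)) := Real.rpow_nonneg hC₀0 _
    have h3 : 0 ≤ a₀ ^ (b * (α + ε)) := Real.rpow_nonneg ha₀0 _
    have h4 : 0 ≤ C₀ ^ (b * (α + ε)) := Real.rpow_nonneg hC₀0 _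
    rw [hQ_def]; linarith
  set Cf : ℝ := (M + SA) + (12 * M * C₀ * Q + SK) with hCf_def
  have hCf : 0 < Cf := by
    have : 0 ≤ 12 * M * C₀ * Q := by positivity
    rw [hCf_def]; linarith
  refine ⟨c₀, T₀, Cf, hc₀, hT₀, hCf, fun E₁ E₂ 𝓔 hE₁ hE₁₂ h𝓔 => ?_⟩
  -- Step 3: run the iteration with the universal `a = max{a₀, C₀E₁, C₀E₂^{1/((2c-1)b-1)}}`
  have hE₁0 : 0 ≤ E₁ := by linarith
  have hE₂1 : 1 ≤ E₂ := hE₁.le.trans hE₁₂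
  have hE₂0 : 0 ≤ E₂ := zero_le_one.trans hE₂1
  set a : ℝ := max a₀ (max (C₀ * E₁) (C₀ * E₂ ^ (1 / ((2 * c - 1) * b - 1)))) with ha_def
  have ha₀a : a₀ ≤ a := le_max_left _ _
  have ha1 : 1 < a := ha₀.trans_le ha₀a
  have ha0 : 0 < a := one_pos.trans ha1
  have hCE₁ : C₀ * E₁ ≤ a := (le_max_left _ _).trans (le_max_right _ _)
  have hCE₂ : C₀ * E₂ ^ (1 / ((2 * c - 1) * b - 1)) ≤ a := (le_max_right _ _).trans (le_max_right _ _)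
  obtain ⟨Λ, v, p, R, hΛ, hv, hcommon⟩ := Ha E₁ E₂ a 𝓔 hE₁ hE₁₂ ha₀a hCE₁ hCE₂ h𝓔
  -- the target maximum
  set T : ℝ := max (E₁ ^ (2 * α + 3 * ε)) (E₂ ^ ((2 * α + 4 * ε) / 3)) with hT_def
  have hT1 : 1 ≤ T := (Real.one_le_rpow hE₁.le (by linarith)).trans (le_max_left _ _)
  -- the amplitudes tend to zero
  have hδ0 : Tendsto (fun q => CDLDR.amp a b (q + 1)) atTop (𝓝 0) := CDLDR.tendsto_amp_succ ha1 hb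
  refine ⟨fun e t x => limUnder atTop (fun q => v e q t x), fun e he => ?_, fun e₁ he₁ e₂ he₂ => ?_⟩
  swap
  · -- (d) the common datum: equal time-zero slices at every stage give equal pointwise limits
    funext x
    exact congrArg (fun f : ℕ → EuclideanSpace ℝ (Fin 3) => limUnder atTop f)
      (funext fun q => congrFun (hcommon e₁ he₁ e₂ he₂ q) x)
  have hS : CDLDR.IsIterationSequence α T₀ M η a b
      (C₀ * max (a ^ (b / (1 - 2 * α)))
        (max (a ^ b * E₁) (E₂ ^ ((c * b - 1 / 2) / ((2 * c - 1) * b - 1)))))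
      Λ e (v e) (p e) (R e) := hv e he
  have hsol := hS.isFracNSReynoldsOn
  have hinc : ∀ q, ∀ t ∈ Icc 0 T₀, ∀ x,
      ‖v e (q + 1) t x - v e q t x‖ ≤ M * Real.sqrt (CDLDR.amp a b (q + 1)) :=
    fun q t ht x => hS.velocity_sup q t ht x
  have hR : ∀ q, ∀ t ∈ Icc 0 T₀, ∀ x, ‖R e q t x‖ ≤ η * CDLDR.amp a b (q + 1) :=
    fun q t ht x => hS.stress_sup q t ht x
  have hv0 : ∀ t ∈ Icc 0 T₀, ∀ x, ‖v e 0 t x‖ ≤ M := fun t ht x => hS.velocity_zero_sup t ht x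
  -- summable sup increments `A_q = M δ_{q+1}^{1/2} ≤ M ρA^{q+1}`
  set A : ℕ → ℝ := fun q => M * Real.sqrt (CDLDR.amp a b (q + 1)) with hA_def
  have hA : Summable A ∧ ∑' q, A q ≤ SA := by
    refine summable_and_tsum_le_of_le_geom hM0 hρA0.le hρA1 (fun q => by positivity) fun q => ?_
    exact cdldr_increment_le_geom ha₀ ha₀a hb hM0 q
  have hincA : ∀ q, ∀ t ∈ Icc 0 T₀, ∀ x, ‖v e (q + 1) t x - v e q t x‖ ≤ A q := hinc
  have hsm : ∀ q, FunctionSpaces.Torus.IsSmoothSpaceTimeOn (Icc 0 T₀) (v e q) := fun q =>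
    (hsol q).smooth_velocity
  -- the pointwise limit `u = lim_q v_{e,q}` on `[0,T₀] × 𝕋³`
  have hu : ∀ t ∈ Icc 0 T₀, ∀ x,
      Tendsto (fun q => v e q t x) atTop (𝓝 (limUnder atTop fun q => v e q t x)) := fun t ht x =>
    tendsto_limUnder_of_norm_sub_succ_le hA.1 hincA ht x
  refine ⟨?_, continuousOn_uncurry_lim hA.1 hincA hu hsm, fun t ht => ?_, fun t ht => ?_⟩
  · -- (a) weak solution: `‖R_q‖₀ ≤ η δ_{q+1} → 0`
    refine isWeakFracNSSolutionOn_lim hT₀ hα.le hA.1 hincA hu hsol (δ := fun q => η * CDLDR.amp a b (q + 1))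
      hR ?_
    simpa using hδ0.const_mul η
  · -- (b) the energy identity
    exact integral_norm_sq_lim hA.1 hincA hu hsm hv0 ht (δ := fun q => CDLDR.amp a b (q + 1))
      (fun q => hS.energy q t ht) hδ0
  · -- (c) the Hölder bound
    have hϑ0 : 0 ≤ α + ε := hϑ.le
    -- sup bound of the limit
    have hsup : ∀ x, ‖limUnder atTop (fun q => v e q t x)‖ ≤ M + SA := fun x =>
      (norm_lim_le hA.1 hincA hu hv0 ht x).trans (by linarith [hA.2])
    -- summable Hölder increments `K_q = 6M δ_{q+1}^{1/2} Λ_{q+1}^ϑ ≤ 12M ρK^{q+1}`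
    -- (`[w]₁ ≤ B` makes the slices `6B`-Lipschitz, `BDSV.lipschitzWith_of_derivSupLE`)
    set K : ℕ → ℝ := fun q => 6 * M * Real.sqrt (CDLDR.amp a b (q + 1)) * (Λ (q + 1) : ℝ) ^ (α + ε)
      with hK_def
    have hK : Summable K ∧ ∑' q, K q ≤ SK := by
      refine summable_and_tsum_le_of_le_geom (by linarith) hρK0.le hρK1 (fun q => by positivity) fun q => ?_
      have hΛq : (Λ (q + 1) : ℝ) ≤ 2 * a ^ (c * b ^ (q + 2)) := (hΛ (q + 1)).2
      have h := cdldr_holderIncrement_le_geom ha₀ ha₀a hb hϑ0 hϑ1 hκ hM0 (Nat.cast_nonneg _) hΛq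
      calc K q = 3 * (2 * M * Real.sqrt (a ^ (-(b ^ (q + 1)))) * (Λ (q + 1) : ℝ) ^ (α + ε)) := by
            simp only [hK_def, CDLDR.amp_def]; ring
        _ ≤ 3 * (4 * M * ρK ^ (q + 1)) := by gcongr
        _ = 12 * M * ρK ^ (q + 1) := by ring
    -- Lipschitz constants of the slices from the `[·]₁`-bounds
    have hLq : ∀ q, ∀ x y, ‖(v e (q + 1) t x - v e q t x) - (v e (q + 1) t y - v e q t y)‖ ≤
        6 * (M * Real.sqrt (CDLDR.amp a b (q + 1)) * (Λ (q + 1) : ℝ)) * dist x y := by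
      intro q x y
      have hB : 0 ≤ M * Real.sqrt (CDLDR.amp a b (q + 1)) * (Λ (q + 1) : ℝ) := by positivity
      have hw : FunctionSpaces.Torus.IsSmooth (fun x => v e (q + 1) t x - v e q t x) :=
        ((hsm (q + 1)).isSmooth_slice ht).sub ((hsm q).isSmooth_slice ht)
      have hL := (BDSV.lipschitzWith_of_derivSupLE hB (hS.velocity_deriv q) ht hw).dist_le_mul x y
      rwa [dist_eq_norm, Real.coe_toNNReal _ (by positivity)] at hL
    have hL0 : ∀ x y, ‖v e 0 t x - v e 0 t y‖ ≤
        6 * (C₀ * max (a ^ (b / (1 - 2 * α)))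
          (max (a ^ b * E₁) (E₂ ^ ((c * b - 1 / 2) / ((2 * c - 1) * b - 1))))) * dist x y := by
      intro x y
      have hAm : 0 ≤ max (a ^ (b / (1 - 2 * α)))
          (max (a ^ b * E₁) (E₂ ^ ((c * b - 1 / 2) / ((2 * c - 1) * b - 1)))) :=
        (Real.rpow_nonneg ha0.le _).trans (le_max_left _ _)
      have hB : 0 ≤ C₀ * max (a ^ (b / (1 - 2 * α)))
          (max (a ^ b * E₁) (E₂ ^ ((c * b - 1 / 2) / ((2 * c - 1) * b - 1)))) := mul_nonneg hC₀0 hAm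
      have hw : FunctionSpaces.Torus.IsSmooth (v e 0 t) := (hsm 0).isSmooth_slice ht
      have hL := (BDSV.lipschitzWith_of_derivSupLE hB hS.velocity_zero_deriv ht hw).dist_le_mul x y
      rwa [dist_eq_norm, Real.coe_toNNReal _ (by positivity)] at hL
    -- the starting slice: `[v_0(t)]_ϑ ≤ 2M (C₀ Amax)^ϑ` by interpolation
    set Amax : ℝ := max (a ^ (b / (1 - 2 * α)))
      (max (a ^ b * E₁) (E₂ ^ ((c * b - 1 / 2) / ((2 * c - 1) * b - 1)))) with hAmax_def
    have hAmax0 : 0 ≤ Amax := (Real.rpow_nonneg ha0.le _).trans (le_max_left _ _)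
    set K₀ : ℝ := 2 * M * (6 * C₀ * Amax) ^ (α + ε) with hK₀_def
    have hK₀0 : 0 ≤ K₀ := by positivity
    have h0 : ∀ x y, ‖v e 0 t x - v e 0 t y‖ ≤ K₀ * dist x y ^ (α + ε) := by
      intro x y
      have hP : ‖v e 0 t x - v e 0 t y‖ ≤ 2 * M :=
        (norm_sub_le _ _).trans (by linarith [hv0 t ht x, hv0 t ht y])
      have hr0 : 0 ≤ 6 * C₀ * Amax * dist x y := by positivity
      have hPr : ‖v e 0 t x - v e 0 t y‖ ≤ 2 * M * (6 * C₀ * Amax * dist x y) := by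
        refine le_trans ?_ (le_mul_of_one_le_left hr0 (by linarith))
        have := hL0 x y
        linarith
      calc ‖v e 0 t x - v e 0 t y‖ ≤ 2 * M * (6 * C₀ * Amax * dist x y) ^ (α + ε) :=
            norm_le_mul_rpow_of_le_of_le_mul (by linarith) hr0 hϑ0 hϑ1 hP hPr
        _ = K₀ * dist x y ^ (α + ε) := by
            rw [hK₀_def, Real.mul_rpow (by positivity) dist_nonneg]; ring
    -- the increments: `[v_{q+1}(t) - v_q(t)]_ϑ ≤ K_q` by interpolation
    have hq : ∀ x y, ∀ q, ‖(v e (q + 1) t x - v e q t x) - (v e (q + 1) t y - v e q t y)‖ ≤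
        K q * dist x y ^ (α + ε) := by
      intro x y q
      have hδq : 0 ≤ Real.sqrt (CDLDR.amp a b (q + 1)) := Real.sqrt_nonneg _
      have hP : ‖(v e (q + 1) t x - v e q t x) - (v e (q + 1) t y - v e q t y)‖ ≤
          6 * (M * Real.sqrt (CDLDR.amp a b (q + 1))) := by
        refine (norm_sub_le _ _).trans ?_
        have : 0 ≤ M * Real.sqrt (CDLDR.amp a b (q + 1)) := by positivity
        linarith [hinc q t ht x, hinc q t ht y]
      have hr0 : 0 ≤ (Λ (q + 1) : ℝ) * dist x y := by positivity
      have hPr : ‖(v e (q + 1) t x - v e q t x) - (v e (q + 1) t y - v e q t y)‖ ≤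
          6 * (M * Real.sqrt (CDLDR.amp a b (q + 1))) * ((Λ (q + 1) : ℝ) * dist x y) := by
        have := hLq q x y
        linarith
      calc ‖(v e (q + 1) t x - v e q t x) - (v e (q + 1) t y - v e q t y)‖
          ≤ 6 * (M * Real.sqrt (CDLDR.amp a b (q + 1))) * ((Λ (q + 1) : ℝ) * dist x y) ^ (α + ε) :=
            norm_le_mul_rpow_of_le_of_le_mul (by positivity) hr0 hϑ0 hϑ1 hP hPr
        _ = K q * dist x y ^ (α + ε) := by
            rw [hK_def, Real.mul_rpow (Nat.cast_nonneg _) dist_nonneg]; ring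
    -- the limit inherits the summed Hölder bound
    have hhold : ∀ x y, ‖limUnder atTop (fun q => v e q t x) - limUnder atTop (fun q => v e q t y)‖ ≤
        (K₀ + SK) * dist x y ^ (α + ε) := by
      intro x y
      have hρ : 0 ≤ dist x y ^ (α + ε) := Real.rpow_nonneg dist_nonneg _
      refine (norm_lim_sub_le hu ht hK.1 hρ (h0 x y) (hq x y)).trans ?_
      exact mul_le_mul_of_nonneg_right (by linarith [hK.2]) hρ
    -- bookkeeping: `K₀ ≤ 2MC₀ · Amax^ϑ ≤ 2MC₀ · Q · T`
    have hAϑ : Amax ^ (α + ε) ≤ Q * T :=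
      cdldr_amax_rpow_le hα hα5 hε hαε hb hc e1 e3 ha₀ hC₀ hE₁ hE₁₂
    have hK₀le : K₀ ≤ 12 * M * C₀ * (Q * T) := by
      have h6C₀ : 1 ≤ 6 * C₀ := by linarith
      have hC₀ϑ : (6 * C₀) ^ (α + ε) ≤ 6 * C₀ := by
        calc (6 * C₀) ^ (α + ε) ≤ (6 * C₀) ^ (1 : ℝ) := Real.rpow_le_rpow_of_exponent_le h6C₀ hϑ1
          _ = 6 * C₀ := Real.rpow_one _
      rw [hK₀_def, Real.mul_rpow (by positivity) hAmax0]
      calc 2 * M * ((6 * C₀) ^ (α + ε) * Amax ^ (α + ε)) ≤ 2 * M * ((6 * C₀) * (Q * T)) := by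
            refine mul_le_mul_of_nonneg_left ?_ (by linarith)
            exact mul_le_mul hC₀ϑ hAϑ (Real.rpow_nonneg hAmax0 _) (by positivity)
        _ = 12 * M * C₀ * (Q * T) := by ring
    have hfinal : (M + SA) + (K₀ + SK) ≤ Cf * T := by
      have h1 : M + SA ≤ (M + SA) * T := le_mul_of_one_le_right (by linarith) hT1
      have h2 : SK ≤ SK * T := le_mul_of_one_le_right hSK0 hT1
      calc (M + SA) + (K₀ + SK) ≤ (M + SA) * T + (12 * M * C₀ * (Q * T) + SK * T) :=
            add_le_add h1 (add_le_add hK₀le h2)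
        _ = Cf * T := by rw [hCf_def]; ring
    show FunctionSpaces.eBoundedHolderNorm (Real.toNNReal (α + ε)) (fun x => limUnder atTop fun q => v e q t x) ≤ _
    calc FunctionSpaces.eBoundedHolderNorm (Real.toNNReal (α + ε)) (fun x => limUnder atTop fun q => v e q t x)
        ≤ ENNReal.ofReal ((M + SA) + (K₀ + SK)) :=
          eBoundedHolderNorm_le_ofReal_add (by linarith) (by linarith) hϑ0 hsup hhold
      _ ≤ ENNReal.ofReal (Cf * T) := ENNReal.ofReal_le_ofReal hfinal

end NS

end Literature.Analysis.FluidPDE
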